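import Literature.NumberTheory.Sieve.LinearEquationsInPrimesProofs
import Literature.NumberTheory.Sieve.PairShiuRough
import HarnessLib

/-!
# Linear equations in primes: the singular product of ONE form in one variable

Topic `Literature/NumberTheory/Sieve`. Everything here is PROVED. For a system consisting of a single
affine-linear form `ψ(n) = a n + b` on `ℤ` (`Ψ : Fin 1 → AffLinForm 1`, `a = ψ̇(e₀) ≠ 0`, `b = ψ(0)`)
Green–Tao's local factors (1.6) and singular product (1.7) are computed in closed form
(sub-namespace `OneForm`):

* `localFactor_eq` — for a prime `p`: `β_p = 1` if `p ∤ a`; `β_p = p/(p−1)` if `p ∣ a`, `p ∤ b`;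
  `β_p = 0` if `p ∣ a`, `p ∣ b` (`β_p = #{c mod p : p ∤ a c + b}/(p − 1)`);
* `singularProductPartial_eq` — for `x ≥ |a|` the partial product `∏_{p ≤ x} β_p` equals
  `∏_{p ∣ a} p/(p−1) = |a|/φ(|a|)` if `gcd(a, b) = 1` and `0` otherwise;
* `singularProduct_eq` — hence `𝔖(Ψ) = ∏_p β_p = 𝟙_{gcd(a,b) = 1} · |a|/φ(|a|)`, the familiar density
  of the primes in the progression `b (mod a)` (Dirichlet; Green–Tao 2010, Example 1 is the case of two
  forms).

## References

* B. Green, T. Tao, *Linear equations in primes*, Ann. of Math. 171 (2010), §1, (1.5)–(1.7).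
  [GreenTao2010]
-/

noncomputable section

open Finset Filter
open scoped Topology

namespace Literature.NumberTheory.Sieve

namespace OneForm

variable (Ψ : Fin 1 → AffLinForm 1)

/-! ### The local factors -/

/-- A one-dimensional form mod `p`: `ψ_p(v) = a v₀ + b`. [folklore] -/
theorem modEval_eq (ψ : AffLinForm 1) (p : ℕ) (v : Fin 1 → ZMod p) :
    ψ.modEval p v = (ψ.coeff 0 : ZMod p) * v 0 + (ψ.const : ZMod p) := by
  simp [AffLinForm.modEval]

/-- Counting over `(ℤ/p)^1` is counting over `ℤ/p`. [folklore] -/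
theorem card_filter_fin_one {p : ℕ} [NeZero p] (Q : ZMod p → Prop) [DecidablePred Q] :
    #{v : Fin 1 → ZMod p | Q (v 0)} = #{x : ZMod p | Q x} := by
  refine Finset.card_nbij' (fun v => v 0) (fun x _ => x) (fun v hv => ?_) (fun x hx => ?_)
    (fun v _ => ?_) (fun x _ => rfl)
  · simpa using hv
  · simpa using hx
  · funext i; simp [Fin.fin_one_eq_zero i]

/-- **The good residues of one form.** For a prime `p`, the number of `c mod p` with `p ∤ a c + b` is
`p − 1` if `p ∤ a`, `p` if `p ∣ a`, `p ∤ b`, and `0` if `p ∣ a`, `p ∣ b`.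
[cite: GreenTao2010, proof of Lemma 1.3] -/
theorem goodCount_eq {p : ℕ} [hp : Fact p.Prime] :
    goodCount Ψ p =
      if (p : ℤ) ∣ (Ψ 0).coeff 0 then (if (p : ℤ) ∣ (Ψ 0).const then 0 else p) else p - 1 := by
  set a : ZMod p := ((Ψ 0).coeff 0 : ZMod p) with ha
  set b : ZMod p := ((Ψ 0).const : ZMod p) with hb
  have hgood : goodCount Ψ p = #{x : ZMod p | ¬ (a * x + b = 0)} := by
    unfold goodCount
    rw [← card_filter_fin_one (fun x => ¬ (a * x + b = 0))]
    congr 1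
    ext v
    simp only [Finset.mem_filter, Finset.mem_univ, true_and, Fin.forall_fin_one, modEval_eq, ha, hb]
  rw [hgood]
  have hcardp : #(Finset.univ : Finset (ZMod p)) = p := by rw [Finset.card_univ, ZMod.card]
  by_cases hpa : (p : ℤ) ∣ (Ψ 0).coeff 0
  · have ha0 : a = 0 := by rw [ha, ZMod.intCast_zmod_eq_zero_iff_dvd]; exact hpa
    rw [if_pos hpa]
    by_cases hpb : (p : ℤ) ∣ (Ψ 0).const
    · have hb0 : b = 0 := by rw [hb, ZMod.intCast_zmod_eq_zero_iff_dvd]; exact hpb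
      rw [if_pos hpb]
      simp [ha0, hb0]
    · have hb0 : b ≠ 0 := by rw [hb, Ne, ZMod.intCast_zmod_eq_zero_iff_dvd]; exact hpb
      rw [if_neg hpb]
      simp [ha0, hb0, hcardp]
  · have ha0 : a ≠ 0 := by rw [ha, Ne, ZMod.intCast_zmod_eq_zero_iff_dvd]; exact hpa
    rw [if_neg hpa]
    -- exactly one root `x = -b/a`
    have hroot : #{x : ZMod p | a * x + b = 0} = 1 := by
      have : (Finset.univ.filter fun x : ZMod p => a * x + b = 0) =
          Finset.univ.filter fun x : ZMod p => x = -b / a := by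
        refine Finset.filter_congr fun x _ => ?_
        rw [eq_div_iff ha0, eq_neg_iff_add_eq_zero, mul_comm]
      rw [this, Finset.filter_eq' Finset.univ (-b / a), if_pos (Finset.mem_univ _), card_singleton]
    have hsum := Finset.card_filter_add_card_filter_not (s := (Finset.univ : Finset (ZMod p)))
      (fun x : ZMod p => a * x + b = 0)
    rw [hroot, hcardp] at hsum
    omega

/-- **The local factors of one form** (Green–Tao (1.6) for `ψ(n) = a n + b`): for a prime `p`,
`β_p = 1` if `p ∤ a`, `β_p = p/(p − 1)` if `p ∣ a` and `p ∤ b`, `β_p = 0` if `p ∣ a` and `p ∣ b`.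
[cite: GreenTao2010, (1.6)] -/
theorem localFactor_eq {p : ℕ} (hp : p.Prime) :
    localFactor Ψ p =
      if (p : ℤ) ∣ (Ψ 0).coeff 0 then (if (p : ℤ) ∣ (Ψ 0).const then 0 else (p : ℝ) / (p - 1))
      else 1 := by
  haveI := Fact.mk hp
  have hp1 : (1 : ℝ) < p := by exact_mod_cast hp.one_lt
  have hp0 : (0 : ℝ) < p := by linarith
  have hpm : (0 : ℝ) < (p : ℝ) - 1 := by linarith
  rw [localFactor_prime, goodCount_eq, pow_one, pow_one]
  by_cases hpa : (p : ℤ) ∣ (Ψ 0).coeff 0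
  · rw [if_pos hpa, if_pos hpa]
    by_cases hpb : (p : ℤ) ∣ (Ψ 0).const
    · rw [if_pos hpb, if_pos hpb]; simp
    · rw [if_neg hpb, if_neg hpb]; field_simp
  · rw [if_neg hpa, if_neg hpa, Nat.cast_sub hp.one_le, Nat.cast_one]
    field_simp

/-! ### The partial products and the singular product -/

/-- **The partial singular products of one form**: for `x ≥ |a|` (`a ≠ 0`),
`∏_{p ≤ x} β_p = ∏_{p ∣ a} p/(p − 1)` if `gcd(a, b) = 1`, and `= 0` otherwise (a common prime
factor `p₀ ≤ |a| ≤ x` of `a, b` has `β_{p₀} = 0`). [cite: GreenTao2010, (1.7)] -/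
theorem singularProductPartial_eq (ha : (Ψ 0).coeff 0 ≠ 0) {x : ℕ}
    (hx : ((Ψ 0).coeff 0).natAbs ≤ x) :
    singularProductPartial Ψ x =
      if Int.gcd ((Ψ 0).coeff 0) ((Ψ 0).const) = 1 then
        ∏ p ∈ ((Ψ 0).coeff 0).natAbs.primeFactors, (p : ℝ) / ((p : ℝ) - 1)
      else 0 := by
  set a : ℤ := (Ψ 0).coeff 0 with ha_def
  set b : ℤ := (Ψ 0).const with hb_def
  have hA0 : a.natAbs ≠ 0 := Int.natAbs_ne_zero.mpr ha
  unfold singularProductPartial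
  have hβ : ∀ p ∈ Nat.primesLE x, localFactor Ψ p =
      if (p : ℤ) ∣ a then (if (p : ℤ) ∣ b then 0 else (p : ℝ) / (p - 1)) else 1 :=
    fun p hp => localFactor_eq Ψ (Nat.mem_primesLE.mp hp).2
  rw [Finset.prod_congr rfl hβ]
  by_cases hg : Int.gcd a b = 1
  · rw [if_pos hg]
    -- no prime divides both `a` and `b`
    have hβ' : ∀ p ∈ Nat.primesLE x,
        (if (p : ℤ) ∣ a then (if (p : ℤ) ∣ b then (0 : ℝ) else (p : ℝ) / (p - 1)) else 1) =
          if p ∣ a.natAbs then (p : ℝ) / (p - 1) else 1 := by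
      intro p hp
      have hpP := (Nat.mem_primesLE.mp hp).2
      by_cases hpa : (p : ℤ) ∣ a
      · have hpa' : p ∣ a.natAbs := Int.natCast_dvd.mp hpa
        have hpb : ¬ (p : ℤ) ∣ b := by
          intro hpb
          have hpb' : p ∣ b.natAbs := Int.natCast_dvd.mp hpb
          have : p ∣ Int.gcd a b := by
            rw [Int.gcd_eq_natAbs]
            exact Nat.dvd_gcd hpa' hpb'
          rw [hg] at this
          exact hpP.one_lt.ne' (Nat.dvd_one.mp this)
        rw [if_pos hpa, if_neg hpb, if_pos hpa']
      · have hpa' : ¬ p ∣ a.natAbs := fun h => hpa (Int.natCast_dvd.mpr h)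
        rw [if_neg hpa, if_neg hpa']
    rw [Finset.prod_congr rfl hβ', Finset.prod_ite, Finset.prod_const_one, mul_one]
    congr 1
    ext p
    rw [Finset.mem_filter, Nat.mem_primesLE, Nat.mem_primeFactors]
    constructor
    · rintro ⟨⟨-, hpP⟩, hpa⟩
      exact ⟨hpP, hpa, hA0⟩
    · rintro ⟨hpP, hpa, -⟩
      exact ⟨⟨(Nat.le_of_dvd (Nat.pos_of_ne_zero hA0) hpa).trans hx, hpP⟩, hpa⟩
  · rw [if_neg hg]
    -- a common prime factor `p₀ ≤ |a| ≤ x` kills the product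
    have hg0 : Int.gcd a b ≠ 0 := fun h => ha (Int.gcd_eq_zero_iff.mp h).1
    have hg2 : 2 ≤ Int.gcd a b := by omega
    obtain ⟨p₀, hp₀, hp₀g⟩ := Nat.exists_prime_and_dvd (n := Int.gcd a b) (by omega)
    have hp₀a : (p₀ : ℤ) ∣ a := (Int.natCast_dvd_natCast.mpr hp₀g).trans (Int.gcd_dvd_left a b)
    have hp₀b : (p₀ : ℤ) ∣ b := (Int.natCast_dvd_natCast.mpr hp₀g).trans (Int.gcd_dvd_right a b)
    have hp₀x : p₀ ≤ x := by
      have h1 : p₀ ≤ Int.gcd a b := Nat.le_of_dvd (by omega) hp₀g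
      have h2 : Int.gcd a b ≤ a.natAbs := by
        rw [Int.gcd_eq_natAbs]
        exact Nat.gcd_le_left _ (Nat.pos_of_ne_zero hA0)
      omega
    refine Finset.prod_eq_zero (i := p₀) (Nat.mem_primesLE.mpr ⟨hp₀x, hp₀⟩) ?_
    rw [if_pos hp₀a, if_pos hp₀b]

/-- **The singular product of one form** `ψ(n) = a n + b` (`a ≠ 0`):
`𝔖(Ψ) = ∏_p β_p = |a|/φ(|a|)` if `gcd(a, b) = 1` and `𝔖(Ψ) = 0` otherwise — the partial products are
constant from `x = |a|` on, and `∏_{p ∣ a} p/(p−1) = |a|/φ(|a|)`. This is the density of the primes in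
the progression `b (mod a)` relative to all primes (Dirichlet). [cite: GreenTao2010, (1.7)] -/
theorem singularProduct_eq (ha : (Ψ 0).coeff 0 ≠ 0) :
    singularProduct Ψ =
      if Int.gcd ((Ψ 0).coeff 0) ((Ψ 0).const) = 1 then
        (((Ψ 0).coeff 0).natAbs : ℝ) / Nat.totient ((Ψ 0).coeff 0).natAbs
      else 0 := by
  have hA0 : ((Ψ 0).coeff 0).natAbs ≠ 0 := Int.natAbs_ne_zero.mpr ha
  set c : ℝ := if Int.gcd ((Ψ 0).coeff 0) ((Ψ 0).const) = 1 then
      ∏ p ∈ ((Ψ 0).coeff 0).natAbs.primeFactors, (p : ℝ) / ((p : ℝ) - 1) else 0 with hc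
  have hev : (fun x => singularProductPartial Ψ x) =ᶠ[atTop] fun _ => c := by
    filter_upwards [eventually_ge_atTop ((Ψ 0).coeff 0).natAbs] with x hx
    rw [hc]
    exact singularProductPartial_eq Ψ ha hx
  have hlim : Tendsto (singularProductPartial Ψ) atTop (𝓝 c) :=
    (tendsto_const_nhds.congr' hev.symm)
  rw [singularProduct, hlim.limUnder_eq, hc]
  split_ifs with hg
  · rw [PairShiu.self_div_totient_eq_prod hA0]
  · rfl

end OneForm

end Literature.NumberTheory.Sieve
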